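import Summits.ValiantsHypothesis.ValiantsHypothesis.Theorems.DepthWindowDualitySteps
import HarnessLib

/-!
# Route `DepthWindow`, g17 — DUALITY HALVING IS A THEOREM: `DualityHalvingAt 8`

Workshop `decomp-valiant`, lens 4 ("depth-reduction / chasm axis"), generation 17.  This file (fifth of
five: `DepthWindowDualitySPS`, `DepthWindowDualityAtoms`, `DepthWindowDualityMonomials`,
`DepthWindowDualitySteps` hold §§1–5) PROVES the theorem-input `DualityHalving` of
`Theorems/DepthWindowDualityHalving.lean` (there an `@[conjecture] def`, used as the hypothesis `hT`
of the payoff theorems): over `ℂ`, every circuit all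
of whose gates compute homogeneous polynomials, of product-depth `Δ` and `s` gates, computing a
degree-`d` form `f` over the variables `σ`, can be replaced by a circuit computing `f` of
product-depth `≤ ⌈Δ/2⌉` with at most `(s + |σ| + 2)^8 · 2^{8d}` gates (`dualityHalvingAt_eight`,
`dualityHalving`).  Consequences, now UNCONDITIONAL: the two currencies of the route's A-cell
agree, `ImmHardAt p q ↔ HomImmHardAt (2p) q` (`immHardAt_iff_homImmHardAt_two_mul_holds`); the open
crux `HomImmHardTwoOne` (item stmt-ValiantsHypothesis-30635) is LITERALLY the inhomogeneous statement
`ImmHardAt 1 1` («IMM_{m,⌊√log₂ m⌋} needs m^{ω(1)} gates at product-depth L₃ m + O(1), no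
homogeneity») (`homImmHardTwoOne_iff_immHardAt_one_one`); DOMINANCE — any homogenisation slope met by
hardness at the same slope gives the crux (`homImmHardTwoOne_of_homAtSlope_hardAt`), in particular the
route's aside `HomSubReach` implies the crux outright (`homImmHardTwoOne_of_homSubReach`).

## The proof (Gupta–Kamath–Kayal–Saptharishi 2016, §4, made blockwise and sparsity-aware)

Gates are processed in order; gate `i` of `D` has the LST product level `D.gatePD i` and the
*truncated value* `tv i := trunc d (D.gateVal i)` (`trunc d` = sum of the homogeneous components of
degree `≤ d`; a gate value is homogeneous, so `tv i` is the value or `0`, and `f = trunc d (D.eval)`).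
The new circuit carries, for every earlier gate `i`, an operand `O i` computing `tv i` at product
level `≤ ⌈gatePD i / 2⌉` (`halving_prefix`).  A gate with constant `tv` becomes a constant operand;
a sum gate and a product gate whose operands have even maximal level `M` are copied with re-mapped
operands (`remap`; levels `⌈(M+1)/2⌉ = M/2 + 1`).  A nonconstant product gate whose operands have
odd maximal level `M = 2k+1` is the DUALITY BLOCK (`step_prod_odd`): its value is
`c₀ · ∏_{u X-type} value(u)` with at most `d` X-type (nonconstant) operands
(`tv_eq_smul_prod_filter`, `length_filter_isX_le`); each such operand is, symbolically over the
ATOMS (variables and nonconstant gates of level `≤ 2k`), a polynomial of degree `≤ d` whose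
monomials are among the `≤ 2s + |σ| + 1` atom monomials `prodMon j` (one per gate: a nonconstant
gate of level `2k+1` is a product of atoms and constants, i.e. ONE monomial; a sum gate of level
`2k+1` is a linear combination of those) — `symC`, `atomSupport`, `support_symC_gateVal_subset`,
`card_atomSupport_le`.  The sparsity-aware GKKS lemmas (§1: Fischer + Saxena duality + univariate
factoring over the algebraically closed field, with the bottom fan-in counted by `|U| 2^t` for a
monomial set `U ⊇` supports instead of all monomials; `exists_circuit_prod_sparse`) write the product
as a `ΣΠΣ` circuit of product-depth `1` in the atoms with `blockSize ≤ 16 N² 64^d` gates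
(`blockSize_succ_le`, `N = s + |σ| + 2`); substituting for each atom the operand representing it
(level `≤ k`, `Operand.substShift`, `depthIn_substShift_le`) gives level `k + 1 = ⌈(2k+2)/2⌉`.
Total `≤ s · 16 N² 64^d ≤ N^8 2^{8d}` (`total_le`).  Degree `0` is the gate-free constant circuit.

Model: Bürgisser's straight-line programs with the LST product-depth (`ArithCircuit`, `gateVal`,
`gatePD`, `gateWDepths prodWeight`; `Literature/…/CircuitGateSemantics.lean`), the splicing toolkit of
`Theorems/DepthWindowHomSubst.lean`, and the kernel GKKS file
`Literature/…/DepthThreeChasmGKKSProofs.lean` (`IsSPS`, `isSPS_dualFactor`, `sparse_fischer`,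
`slotCircuit`).  Everything is proved (0 sorry, no new axioms); no `def … : Prop`.
[cite: GuptaKamathKayalSaptharishi2016, §4, Lemma 4.3, Lemma 4.4, Lemma 4.6, Lemma 4.7]
[cite: LimayeSrinivasanTavenas2025, Lemma 11] [cite: Burgisser2000, Def. 2.1] [cite: LST2021, §2]
-/

-- layout Summits/ValiantsHypothesis/ValiantsHypothesis forces the duplicated namespace component
set_option linter.dupNamespace false

namespace Summit.ValiantsHypothesis.ValiantsHypothesis.Theorems.DepthWindow

open MvPolynomial Literature.Computability.AlgebraicComplexity ArithCircuit
open Literature.Computability.AlgebraicComplexity.DepthReduction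
open Literature.Computability.AlgebraicComplexity.DepthThreeChasm

section Halving

variable {σ : Type*} {d : ℕ} {D : ArithCircuit ℂ σ} [Fintype σ] [DecidableEq σ]

/-- Case (d): **the duality block**.  A product gate `m` with nonconstant truncated value whose
operands have ODD maximal level `M = L + 1` is replaced by the GKKS `ΣΠΣ` expression of the
product of its X-type operands over the atoms of level `≤ L`, spliced onto the accumulator by
substituting for each atom the operand that represents it.
[cite: GuptaKamathKayalSaptharishi2016, §4, Lemmas 4.3, 4.4, 4.6, 4.7] -/
theorem step_prod_odd (hd : 1 ≤ d) (h : ∀ g ∈ gateValues D.gates, ∃ e : ℕ, g.IsHomogeneous e)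
    {m : ℕ} {us : List (Operand ℂ σ)} (hg : D.gates[m]? = some (.prod us))
    (hk : (tv d D m).totalDegree ≠ 0) {k : ℕ} (hM : D.gatePD m = 2 * k + 2)
    (Acc : List (Gate ℂ σ)) (O : ℕ → Operand ℂ σ)
    (h1 : ∀ i < m, (O i).RefsBelow Acc.length)
    (h2 : ∀ i < m, (O i).eval (gateValues Acc) = tv d D i)
    (h3 : ∀ i < m, (O i).depthIn (gateWDepths prodWeight Acc) ≤ (D.gatePD i + 1) / 2) :
    ∃ (T : List (Gate ℂ σ)) (new : Operand ℂ σ), new.RefsBelow (Acc ++ T).length ∧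
      new.eval (gateValues (Acc ++ T)) = tv d D m ∧
      new.depthIn (gateWDepths prodWeight (Acc ++ T)) ≤ (D.gatePD m + 1) / 2 ∧
      T.length ≤ blockSize (2 * D.size + Fintype.card σ + 1) d + 1 := by
  have hm : m < D.size := lt_size_of_tv d D hk
  haveI : Inhabited (Fin D.size ⊕ σ) := ⟨Sum.inl ⟨m, hm⟩⟩
  set L := 2 * k with hL
  -- the X-type operands and their symbolic representations
  set usX := us.filter (isX d D m) with husX
  have hW : usX.length ≤ d := length_filter_isX_le d h hg hk
  have hops : ∀ u ∈ us, D.opPD m u ≤ L + 1 := fun u hu => by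
    have := opPD_succ_le_gatePD_of_prod D hg hu
    omega
  set p : Fin usX.length → MvPolynomial (Fin D.size ⊕ σ) ℂ :=
    fun idx => (symC d D L).opVal m ((usX[idx.1]).rename Sum.inr) with hp
  have hpU : ∀ idx, (p idx).support ⊆ atomSupport d D := fun idx =>
    support_symC_opVal_subset d L m _ (hops _ (List.mem_of_mem_filter (List.getElem_mem idx.2)))
  have hpdeg : ∀ idx, (p idx).totalDegree ≤ d := fun idx =>
    totalDegree_le_of_support_subset d D hd h (hpU idx)
  obtain ⟨C₀, hC₀c, hC₀d, hC₀s⟩ :=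
    exists_circuit_prod_sparse (atomSupport d D) usX.length hW p hpdeg hpU
  -- the substitution of atoms by their representing operands
  set θ : Fin D.size ⊕ σ → Operand ℂ σ := Sum.elim
    (fun j => if (tv d D j).totalDegree ≠ 0 ∧ D.gatePD j ≤ L ∧ (j : ℕ) < m then O j else .const 0)
    (fun t => .var t) with hθdef
  have hθ : ∀ v, (θ v).RefsBelow Acc.length := by
    rintro (j | t)
    · simp only [hθdef, Sum.elim_inl]
      split_ifs with hc
      · exact h1 j hc.2.2
      · trivial
    · simp [hθdef, Operand.RefsBelow]
  have hθM : ∀ v, (θ v).depthIn (gateWDepths prodWeight Acc) ≤ k := by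
    rintro (j | t)
    · simp only [hθdef, Sum.elim_inl]
      split_ifs with hc
      · refine (h3 j hc.2.2).trans ?_
        have := hc.2.1
        omega
      · simp [Operand.depthIn]
    · simp [hθdef, Operand.depthIn]
  set Θ : Fin D.size ⊕ σ → MvPolynomial σ ℂ := fun v => (θ v).eval (gateValues Acc) with hΘdef
  have hΘv : ∀ t, Θ (Sum.inr t) = X t := fun t => by simp [hΘdef, hθdef, Operand.eval]
  have hΘa : ∀ j : Fin D.size, (j : ℕ) < m → (tv d D j).totalDegree ≠ 0 → D.gatePD j ≤ L →
      Θ (Sum.inl j) = tv d D j := fun j hj hkj hLj => by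
    simp only [hΘdef, hθdef, Sum.elim_inl, if_pos (And.intro hkj (And.intro hLj hj))]
    exact h2 j hj
  -- the block and the output gate
  set c₀ : ℂ := ((us.filter fun u => !isX d D m u).map (cval d D m)).prod with hc₀
  set Block := C₀.gates.map (Gate.substShift θ Acc.length) with hBlock
  set outOp := Operand.substShift θ Acc.length C₀.output with houtOp
  set g' : Gate ℂ σ := Gate.sum [(c₀, outOp)] with hg'
  have hVA : (gateValues Acc).length = Acc.length := gateValues_length Acc
  have hDA : (gateWDepths prodWeight Acc).length = Acc.length := gateWDepths_length _ _
  have hVB : gateValues (Acc ++ Block) =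
      gateValues Acc ++ (gateValues C₀.gates).map (substMap θ (gateValues Acc)) :=
    gateValues_append_substShift θ Acc hθ C₀.gates
  have hlenB : (Acc ++ Block).length = Acc.length + C₀.gates.length := by
    rw [List.length_append, hBlock, List.length_map]
  refine ⟨Block ++ [g'], .gate (Acc.length + C₀.gates.length), ?_, ?_, ?_, ?_⟩
  · simp only [Operand.RefsBelow, List.length_append, hBlock, List.length_map, List.length_singleton]
    omega
  · -- value
    rw [← List.append_assoc, ← hlenB, eval_gate_last, hg', Gate.eval]
    simp only [List.map_cons, List.map_nil, List.sum_cons, List.sum_nil, add_zero]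
    have key := eval_substShift θ (gateValues Acc) (by rw [hVA]; exact hθ) (gateValues C₀.gates)
      C₀.output
    rw [hVA] at key
    rw [hVB, houtOp, key]
    have hev : C₀.output.eval (gateValues C₀.gates) = ∏ idx, p idx := hC₀c
    rw [hev, substMap, map_prod]
    have hfac : ∀ idx : Fin usX.length, aeval Θ (p idx) = trunc d (D.opVal m (usX[idx.1])) :=
      fun idx => aeval_symC_opVal d hd h L m Θ hΘv hΘa _
    simp only [hΘdef] at hfac
    simp only [hfac]
    rw [Fin.prod_univ_fun_getElem usX (fun u => trunc d (D.opVal m u)), hc₀, husX,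
      ← tv_eq_smul_prod_filter d h hg hk]
  · -- depth
    rw [← List.append_assoc, ← hlenB, depthIn_gate_last, hg']
    have hw : prodWeight (Gate.sum [(c₀, outOp)] : Gate ℂ σ) = 0 := by simp [prodWeight, Gate.isProd]
    rw [hw, Nat.zero_add, Gate.args]
    simp only [List.map_cons, List.map_nil, List.foldr_cons, List.foldr_nil, Nat.max_zero]
    obtain ⟨Dnew, hDnew, hDlen⟩ := gateWDepths_prefix prodWeight Acc Block
    rw [hBlock, List.length_map] at hDlen
    have hnew : ∀ i < (gateWDepths prodWeight C₀.gates).length,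
        Dnew.getD i 0 ≤ (gateWDepths prodWeight C₀.gates).getD i 0 + k := by
      intro i hi
      rw [gateWDepths_length] at hi
      have := getD_gateWDepths_append_substShift_le θ Acc k hθ hθM C₀.gates i hi
      rwa [← hBlock, hDnew, ← hDA, List.getD_append_right _ _ _ _ (Nat.le_add_right _ _),
        Nat.add_sub_cancel_left] at this
    rw [hDnew, houtOp, ← hDA]
    refine (depthIn_substShift_le θ _ _ Dnew k (by rw [hDA]; exact hθ) hθM
      (hDlen.trans (gateWDepths_length _ _).symm) hnew C₀.output).trans ?_
    have hpd : C₀.output.depthIn (gateWDepths prodWeight C₀.gates) = C₀.productDepth := rfl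
    rw [hpd, hM]
    omega
  · -- size
    rw [List.length_append, List.length_singleton, hBlock, List.length_map]
    have hU := card_atomSupport_le d D
    have hs : C₀.gates.length ≤ blockSize (atomSupport d D).card d := hC₀s
    have hmono : blockSize (atomSupport d D).card d ≤
        blockSize (2 * D.size + Fintype.card σ + 1) d := by
      unfold blockSize
      gcongr
    omega

/-- **The halving induction**: after the first `m` gates of `D` there is an accumulator of at most
`m · perGate` gates in which every earlier gate `i` is represented by an operand computing its
truncated value at product level `≤ ⌈level(i)/2⌉`. [cite: GuptaKamathKayalSaptharishi2016, §4] -/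
theorem halving_prefix (hd : 1 ≤ d) (h : ∀ g ∈ gateValues D.gates, ∃ e : ℕ, g.IsHomogeneous e) :
    ∀ m, m ≤ D.size → ∃ (Acc : List (Gate ℂ σ)) (O : ℕ → Operand ℂ σ),
      (∀ i < m, (O i).RefsBelow Acc.length) ∧
      (∀ i < m, (O i).eval (gateValues Acc) = tv d D i) ∧
      (∀ i < m, (O i).depthIn (gateWDepths prodWeight Acc) ≤ (D.gatePD i + 1) / 2) ∧
      Acc.length ≤ m * perGate (D.size + Fintype.card σ + 2) d := by
  intro m
  induction m with
  | zero => intro _; exact ⟨[], fun _ => .const 0, by simp, by simp, by simp, by simp⟩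
  | succ m ih =>
      intro hm
      obtain ⟨Acc, O, h1, h2, h3, h4⟩ := ih (Nat.le_of_succ_le hm)
      have hm' : m < D.size := hm
      have hN : 2 ≤ D.size + Fintype.card σ + 2 := by omega
      -- one of the four cases supplies `T` and `new`
      have hcase : ∃ (T : List (Gate ℂ σ)) (new : Operand ℂ σ), new.RefsBelow (Acc ++ T).length ∧
          new.eval (gateValues (Acc ++ T)) = tv d D m ∧
          new.depthIn (gateWDepths prodWeight (Acc ++ T)) ≤ (D.gatePD m + 1) / 2 ∧
          T.length + 1 ≤ perGate (D.size + Fintype.card σ + 2) d := by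
        have hsmall : (1 : ℕ) + 1 ≤ perGate (D.size + Fintype.card σ + 2) d :=
          le_trans (by omega) (blockSize_succ_le (u := 0) hd hN (Nat.zero_le _))
        by_cases hk : (tv d D m).totalDegree = 0
        · obtain ⟨T, new, n1, n2, n3, hT⟩ := step_const (d := d) (D := D) Acc hk
          exact ⟨T, new, n1, n2, n3, by omega⟩
        obtain ⟨g, hg⟩ : ∃ g, D.gates[m]? = some g := ⟨D.gates[m], List.getElem?_eq_getElem hm'⟩
        cases g with
        | sum args =>
            obtain ⟨T, new, n1, n2, n3, hT⟩ := step_sum hd hg Acc O h2 h3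
            exact ⟨T, new, n1, n2, n3, by omega⟩
        | prod us =>
            have hpd := gatePD_of_prod D hg
            set M := (us.map (D.opPD m)).foldr max 0 with hMdef
            rcases Nat.even_or_odd M with hMe | hMo
            · obtain ⟨T, new, n1, n2, n3, hT⟩ := step_prod_even hd h hg hk hpd hMe Acc O h2 h3
              exact ⟨T, new, n1, n2, n3, by omega⟩
            · obtain ⟨k, hk2⟩ := hMo
              have hM : D.gatePD m = 2 * k + 2 := by rw [hpd, hk2]
              obtain ⟨T, new, n1, n2, n3, hT⟩ := step_prod_odd hd h hg hk hM Acc O h1 h2 h3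
              refine ⟨T, new, n1, n2, n3, ?_⟩
              exact le_trans (by omega) (blockSize_succ_le
                (u := 2 * D.size + Fintype.card σ + 1) hd hN (by omega))
      obtain ⟨T, new, n1, n2, n3, hT⟩ := hcase
      obtain ⟨O', g1, g2, g3⟩ := inv_extend h1 h2 h3 n1 n2 n3
      refine ⟨Acc ++ T, O', g1, g2, g3, ?_⟩
      rw [List.length_append, Nat.succ_mul]
      omega

/-- **Duality halving holds with exponent `8`** (statement `DualityHalvingAt` of
`Theorems/DepthWindowDualityHalving.lean`): every every-gate-homogeneous circuit of product-depth
`Δ` and `s` gates computing a degree-`d` form over `ℂ` can be replaced by a circuit of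
product-depth `≤ ⌈Δ/2⌉` and at most `(s + |σ| + 2)^8 · 2^{8d}` gates computing the same form.
Proof: the halving induction `halving_prefix` (GKKS 2016 §4 blockwise: Fischer + Saxena duality +
univariate factoring over `ℂ`, with the sparsity of the bottom layer bounded by the number of
gates). [cite: GuptaKamathKayalSaptharishi2016, §4, Lemmas 4.3, 4.4, 4.6, 4.7] -/
theorem dualityHalvingAt_eight : DualityHalvingAt 8 := by
  intro σ _ d f hf D hD hDf
  classical
  rcases Nat.eq_zero_or_pos d with hd0 | hd
  · -- degree 0: `f` is a constant
    subst hd0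
    have h0 : f.totalDegree = 0 := (totalDegree_zero_iff_isHomogeneous _).2 hf
    refine ⟨ArithCircuit.ofConst (coeff 0 f), ?_, by rw [productDepth_ofConst]; exact Nat.zero_le _,
      by rw [ArithCircuit.size_ofConst]; exact Nat.zero_le _⟩
    show (ArithCircuit.ofConst (coeff 0 f)).eval = f
    rw [ArithCircuit.eval_ofConst]
    exact (totalDegree_eq_zero_iff_eq_C.1 h0).symm
  obtain ⟨Acc, O, h1, h2, h3, h4⟩ := halving_prefix hd hD D.size le_rfl
  refine ⟨⟨Acc, remap O D.size D.output⟩, ?_, ?_, ?_⟩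
  · show Operand.eval (gateValues Acc) (remap O D.size D.output) = f
    rw [eval_remap d D hd h2, ← eval_eq_opVal_output]
    have hDf' : D.eval = f := hDf
    rw [hDf']
    exact trunc_of_isHomogeneous_le hf le_rfl
  · show Operand.depthIn (gateWDepths (fun g => if g.isProd then 1 else 0) Acc)
        (remap O D.size D.output) ≤ _
    have hpw : (fun g : Gate ℂ σ => if g.isProd then 1 else 0) = prodWeight := rfl
    rw [hpw, productDepth_eq_opPD_output]
    exact depthIn_remap_le D h3 D.output
  · show Acc.length ≤ _
    exact h4.trans (total_le _ _ _ (by omega) (by omega))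

/-- **Duality halving** (`DualityHalving`). [cite: GuptaKamathKayalSaptharishi2016, §4] -/
theorem dualityHalving : DualityHalving := ⟨8, dualityHalvingAt_eight⟩

/-! ### 6. Unconditional consequences for the route `DepthWindow` -/

/-- **The A-cell in two currencies, unconditionally**: `ImmHardAt p q ↔ HomImmHardAt (2p) q`.
[cite: GuptaKamathKayalSaptharishi2016, Lemma 4.6] [cite: LimayeSrinivasanTavenas2025, Lemma 11] -/
theorem immHardAt_iff_homImmHardAt_two_mul_holds {p q : ℕ} : ImmHardAt p q ↔ HomImmHardAt (2 * p) q :=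
  immHardAt_iff_homImmHardAt_two_mul dualityHalvingAt_eight

/-- **The open crux is the inhomogeneous statement**: `HomImmHardTwoOne ↔ ImmHardAt 1 1`, i.e. the
crux item stmt-ValiantsHypothesis-30635 says exactly «for every `c`, eventually every circuit (no
homogeneity) of product-depth `≤ L₃ m + c` computing `IMM_{m,⌊√log₂ m⌋}` has more than `m^c + c`
gates». [cite: GuptaKamathKayalSaptharishi2016, Lemma 4.6] [cite: LimayeSrinivasanTavenas2025, Lemma 11] -/
theorem homImmHardTwoOne_iff_immHardAt_one_one :
    Summit.ValiantsHypothesis.ValiantsHypothesis.Theses.DepthWindow.HomImmHardTwoOne ↔ ImmHardAt 1 1 := by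
  have h := immHardAt_iff_homImmHardAt_two_mul (p := 1) (q := 1) dualityHalvingAt_eight
  rw [Nat.mul_one] at h
  exact h.symm

/-- **Dominance, unconditionally**: homogenisation at ANY slope `p/q` met by homogeneous hardness at
the same slope yields the crux `HomImmHardTwoOne`. [cite: LimayeSrinivasanTavenas2025, Lemma 11]
[cite: GuptaKamathKayalSaptharishi2016, Lemma 4.6] -/
theorem homImmHardTwoOne_of_homAtSlope_hardAt {p q : ℕ} (hHom : HomAtSlope p q)
    (hHard : HomImmHardAt p q) :
    Summit.ValiantsHypothesis.ValiantsHypothesis.Theses.DepthWindow.HomImmHardTwoOne := by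
  obtain ⟨c₀, a, hH⟩ := hHom
  exact homImmHardAt_two_one_of_homAt_hardAt dualityHalvingAt_eight hH hHard

/-- **The aside `HomSubReach` implies the crux `HomImmHardTwoOne`, unconditionally** (BDS hardness
at slope `≤ 7/5` is kernel: `homImmHardAt_of_five_mul_le`). [cite: BhargavDuttaSaxena2024, Thm. 1.4, Rem. 1.5]
[cite: GuptaKamathKayalSaptharishi2016, Lemma 4.6] -/
theorem homImmHardTwoOne_of_homSubReach
    (hA1 : Summit.ValiantsHypothesis.ValiantsHypothesis.Theses.DepthWindow.HomSubReach) :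
    Summit.ValiantsHypothesis.ValiantsHypothesis.Theses.DepthWindow.HomImmHardTwoOne :=
  homImmHardAt_two_one_of_homSubReach dualityHalving hA1

/-- Hence `HomSubReach → PerHardLog3` factors through the crux with NO theorem-input left
(`perHardLog3Glue3`'s first hypothesis discharged from the aside). [cite: LimayeSrinivasanTavenas2025, Lemma 11, Lemma 12] -/
theorem perHardLog3_of_slopeRate_via_two_holds {p q : ℕ} (hHom : HomAtSlope p q)
    (hHard : HomImmHardAt p q) :
    Summit.ValiantsHypothesis.ValiantsHypothesis.Theses.DepthWindow.PerHardLog3 :=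
  perHardLog3_of_slopeRate_via_two dualityHalvingAt_eight hHom hHard

end Halving

end Summit.ValiantsHypothesis.ValiantsHypothesis.Theorems.DepthWindow
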